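/-
  Summits/AtomisticToContinuum/Crystallization/Theorems/OverbindingBudgetAffineFarCoreRechart.lean

  residual stmt-AtomisticToContinuum-31280 · slot Z `FarAggregatePricing 12 (1/25) (1/2000) (1/(2·10⁷))` · leaf LAB₁′ `ShelteredShellLabelling'`
  (leaf list v14′, critic rows 890/899): ★ CORE `coreRechart_holds : CoreRechart (1/25)` — the engine piece E3 of LAB₁′ ⟸ R_aff′ ∧ BBI₀ ∧ CORE
  (critic row 899 docket (2)).  decomp-a2c lens-4 «minimal counterexample / extremal reduction», generation 58.  Imports C4 `…FarCoreWindow`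
  (→ C3, C2, C1, A1, K2 and the `…FarRechart` chain).  0 sorry · 0 axiom · no instance · no notation · no option.
-/
import Summits.AtomisticToContinuum.Crystallization.Theorems.OverbindingBudgetAffineFarCoreWindow

/-! # ★ CORE — two ε-matched affine charts of close-packed stackings recentre into one another (PROVED)

`CoreRechart θ` (typed g56/g57, bc/EngineSketchV2): an admissible `θ`-chart `c = ⟨c.s, c.B, c.a₀, c.nn⟩` of the configuration `y` at `i`
(`IsChart C ε₁ y i c`: two-way `Cε₁nn`-matching of the `9nn`-window with `y i + c.a₀ c.B 𝓛(c.s)`) and a second two-way `ηnn`-matching of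
the same window with a based copy `y i + a₀ B₀ g(𝓛(s) − p₀)` force a RECHART `c'` of `c` (`Recharts θ c c'`) whose structure is EXACTLY the
recentred stacking: `𝓛(c'.s) = 𝓛(s) − p₀`.  Proof (lens-4, minimal counterexample): matched pairs `‖c.a₀ c.B x − a₀ B₀ z‖ ≤ ε = (Cε₁+η)nn`;
scale bounds incl. the Archimedean lower bound `a₀ ≥ (25/28)(99/100) nn` (C4); first shells match and give the origin isometry `U` (C3);
identification `z = U x` throughout the window by the step lemma and a minimal counterexample (C2); the linear defect
`D = c.a₀ c.B − a₀ B₀ U` is `ε`-small on the identified net, hence `‖D‖ ≤ 4ε/17` (C1 §5, C4); the recentred word `n ↦ s (n + k₀)` and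
`R = U⁻¹ g` assemble `c' = ⟨s(· + k₀), c.B ∘ R, c.a₀, c.nn⟩` (`core_assembly`).  Axioms of `coreRechart_holds`: propext, Classical.choice,
Quot.sound (farm `--axioms`).
-/

namespace Summit.AtomisticToContinuum.Crystallization.Theorems.OverbindingBudgetAffineFarSmoothSplit

open scoped BigOperators RealInnerProductSpace
open Literature.MathematicalPhysics.StatisticalMechanics
open Literature.Geometry.DiscreteGeometry (layerShell hexagonSet hexagonSet_subset_layerShell nearestDist nearestDist_nonneg
  nearestDist_le_dist)

/-! ## §1  The target (verbatim from the engine sketch g57 `bc/EngineSketchV2.lean`) -/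

/-- **CORE · `CoreRechart θ`**: two ε-matched affine charts of close-packed stackings over the same `9nn`-window recentre into one another. -/
def CoreRechart (θ : ℝ) : Prop :=
  ∀ (C η ε₁ : ℝ), 0 ≤ C → 0 ≤ η → 0 < ε₁ → C * ε₁ ≤ 1 / 100 → η ≤ 1 / 100 →
    ∀ (N : ℕ) (y : Fin N → EuclideanSpace ℝ (Fin 3)) (i : Fin N) (c : Chart), IsChart C ε₁ y i c → ChartAdmissible θ c →
      ∀ (a₀ : ℝ) (B₀ : EuclideanSpace ℝ (Fin 3) →ₗ[ℝ] EuclideanSpace ℝ (Fin 3)) (s : ℤ → ℤ)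
        (g : EuclideanSpace ℝ (Fin 3) ≃ₗᵢ[ℝ] EuclideanSpace ℝ (Fin 3)) (p₀ : EuclideanSpace ℝ (Fin 3)),
        0 < a₀ → (∃ Q₀ : EuclideanSpace ℝ (Fin 3) →ₗᵢ[ℝ] EuclideanSpace ℝ (Fin 3), ∀ v, ‖B₀ v - Q₀ v‖ ≤ 3 * θ * ‖v‖) →
        IsHaggSeq s → p₀ ∈ barlowStacking 1 (Real.sqrt (2 / 3)) s →
        (∀ k : Fin N, dist (y k) (y i) ≤ 9 * nearestDist y i →
          ∃ q ∈ barlowStacking 1 (Real.sqrt (2 / 3)) s, dist (y k) (y i + a₀ • B₀ (g (q - p₀))) ≤ η * nearestDist y i) →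
        (∀ q ∈ barlowStacking 1 (Real.sqrt (2 / 3)) s, a₀ * ‖B₀ (g (q - p₀))‖ ≤ 9 * nearestDist y i →
          ∃ k : Fin N, dist (y k) (y i + a₀ • B₀ (g (q - p₀))) ≤ η * nearestDist y i) →
        ∃ (c' : Chart) (R₀ : EuclideanSpace ℝ (Fin 3) ≃ₗᵢ[ℝ] EuclideanSpace ℝ (Fin 3)), Recharts θ c c' ∧
          ∀ p : EuclideanSpace ℝ (Fin 3),
            p ∈ barlowStacking 1 (Real.sqrt (2 / 3)) c'.s ↔ R₀ p + p₀ ∈ barlowStacking 1 (Real.sqrt (2 / 3)) s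

/-! ## §2  Assembly of the rechart (PROVED) -/

/-- **Assembly of the rechart** `c' = ⟨s(· + k₀), c.B ∘ R, c.a₀, c.nn⟩` from the window equivalence. [this file] -/
theorem core_assembly {c : Chart} (hca : 0 < c.a₀) (hcnn : 0 < c.nn)
    (hcB : ∃ Q : EuclideanSpace ℝ (Fin 3) →ₗᵢ[ℝ] EuclideanSpace ℝ (Fin 3), ∀ v : EuclideanSpace ℝ (Fin 3), ‖c.B v - Q v‖ ≤ 3 * (1 / 25) * ‖v‖)
    (hmin : ∀ p ∈ barlowStacking 1 (Real.sqrt (2 / 3)) c.s, p ≠ 0 → c.nn ≤ c.a₀ * ‖c.B p‖) {pm : EuclideanSpace ℝ (Fin 3)}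
    (hpmX : pm ∈ barlowStacking 1 (Real.sqrt (2 / 3)) c.s) (hpm0 : pm ≠ 0) (hpmeq : c.nn = c.a₀ * ‖c.B pm‖)
    {s : ℤ → ℤ} (hs : IsHaggSeq s) {k₀ i₀ j₀ : ℤ} {p₀ : EuclideanSpace ℝ (Fin 3)} (hp₀ : p₀ = barlowPos 1 (Real.sqrt (2 / 3)) s k₀ i₀ j₀)
    (R : EuclideanSpace ℝ (Fin 3) ≃ₗᵢ[ℝ] EuclideanSpace ℝ (Fin 3))
    (KEY : ∀ p : EuclideanSpace ℝ (Fin 3), c.a₀ * ‖c.B (R p)‖ < 44 / 5 * c.nn →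
      (R p ∈ barlowStacking 1 (Real.sqrt (2 / 3)) c.s ↔ p + p₀ ∈ barlowStacking 1 (Real.sqrt (2 / 3)) s)) :
    ∃ (c' : Chart) (R₀ : EuclideanSpace ℝ (Fin 3) ≃ₗᵢ[ℝ] EuclideanSpace ℝ (Fin 3)), Recharts (1 / 25) c c' ∧
      ∀ p : EuclideanSpace ℝ (Fin 3), p ∈ barlowStacking 1 (Real.sqrt (2 / 3)) c'.s ↔ R₀ p + p₀ ∈ barlowStacking 1 (Real.sqrt (2 / 3)) s := by
  have KEY' : ∀ p : EuclideanSpace ℝ (Fin 3), c.a₀ * ‖c.B (R p)‖ < 44 / 5 * c.nn →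
      (R p ∈ barlowStacking 1 (Real.sqrt (2 / 3)) c.s ↔ p ∈ barlowStacking 1 (Real.sqrt (2 / 3)) (fun n => s (n + k₀))) :=
    fun p hp => (KEY p hp).trans (mem_shift_iff hp₀ p).symm
  have hs' : IsHaggSeq (fun n => s (n + k₀)) := fun n => hs (n + k₀)
  obtain ⟨Q, hQ⟩ := hcB
  have hQ' : ∃ Q' : EuclideanSpace ℝ (Fin 3) →ₗᵢ[ℝ] EuclideanSpace ℝ (Fin 3), ∀ v, ‖(c.B ∘ₗ (R.toLinearEquiv : EuclideanSpace ℝ (Fin 3) →ₗ[ℝ] EuclideanSpace ℝ (Fin 3))) v - Q' v‖ ≤ 3 * (1 / 25) * ‖v‖ :=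
    ⟨Q.comp R.toLinearIsometry, fun v => by rw [← R.norm_map v]; exact hQ (R v)⟩
  have hB' : ∀ p, (c.B ∘ₗ (R.toLinearEquiv : EuclideanSpace ℝ (Fin 3) →ₗ[ℝ] EuclideanSpace ℝ (Fin 3))) p = c.B (R p) := fun p => rfl
  refine ⟨⟨fun n => s (n + k₀), c.B ∘ₗ (R.toLinearEquiv : EuclideanSpace ℝ (Fin 3) →ₗ[ℝ] EuclideanSpace ℝ (Fin 3)), c.a₀, c.nn⟩, LinearIsometryEquiv.refl ℝ (EuclideanSpace ℝ (Fin 3)),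
    ⟨⟨hs', hca, hcnn, hQ', ?_, ?_, ?_⟩, rfl, rfl, R, hB', KEY'⟩, fun p => mem_shift_iff hp₀ p⟩
  · -- `c.nn` is a lower bound of the new reference distances
    intro p hp hp0
    show c.nn ≤ c.a₀ * ‖(c.B ∘ₗ (R.toLinearEquiv : EuclideanSpace ℝ (Fin 3) →ₗ[ℝ] EuclideanSpace ℝ (Fin 3))) p‖
    rw [hB']
    by_cases h8 : c.a₀ * ‖c.B (R p)‖ < 44 / 5 * c.nn
    · refine hmin (R p) ((KEY' p h8).2 hp) fun h0 => hp0 ?_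
      exact R.injective (h0.trans (map_zero R).symm)
    · push Not at h8; linarith
  · -- and it is attained, at `R⁻¹` of the attained site of `c`
    refine ⟨R.symm pm, (KEY' (R.symm pm) ?_).1 (by rw [R.apply_symm_apply]; exact hpmX), fun h => hpm0 ?_, ?_⟩
    · rw [R.apply_symm_apply, ← hpmeq]; linarith
    · rw [← R.apply_symm_apply pm, h, map_zero]
    · show c.nn = c.a₀ * ‖(c.B ∘ₗ (R.toLinearEquiv : EuclideanSpace ℝ (Fin 3) →ₗ[ℝ] EuclideanSpace ℝ (Fin 3))) (R.symm pm)‖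
      rw [hB', R.apply_symm_apply]; exact hpmeq
  · -- summability of the new site-energy series (`…AffineBarlowSum`)
    exact summable_lennardJones_chart hs' (m := 3 * (1 / 25)) (by norm_num) hQ' hca

/-! ## §3  ★ CORE (PROVED) -/

/-- **★ CORE (PROVED): `CoreRechart (1/25)`.**  See the file docstring for the architecture; the sub-results are C1 (lattice products, dual gap,
covering constant, inward neighbour, net bound), C2 (step lemma, identification by minimal counterexample), C3 (first shells match, origin
isometry), and §2–§3 above. [this file] -/
theorem coreRechart_holds : CoreRechart (1 / 25) := by
  intro C η ε₁ hC hη hε₁ hCε hη1 N y i c hchart hadm a₀ B₀ s g p₀ ha₀ hB₀ hs hp₀ hsite hpt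
  obtain ⟨hnn1, hcl2, hcl3⟩ := hchart
  obtain ⟨hcs, hca, hcnn, hcB, hmin, ⟨pm, hpmX, hpm0, hpmeq⟩, -⟩ := hadm
  obtain ⟨hlo, hhi⟩ := near_iso_bounds hcB
  obtain ⟨hlo₀, hhi₀⟩ := near_iso_bounds hB₀
  have h72 : (7 / 5 : ℝ) < Real.sqrt 2 := (by rw [show (7 / 5 : ℝ) = Real.sqrt ((7 / 5) ^ 2) by rw [Real.sqrt_sq (by norm_num)]]; exact Real.sqrt_lt_sqrt (by norm_num) (by norm_num) : (7 / 5 : ℝ) < Real.sqrt 2)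
  -- the length unit `nn > 0` and the accuracy `ε`
  have hnn0 : 0 ≤ nearestDist y i := nearestDist_nonneg y i
  have hb : C * ε₁ * nearestDist y i ≤ nearestDist y i / 100 := by
    have := mul_le_mul_of_nonneg_right hCε hnn0; linarith
  have hηnn : η * nearestDist y i ≤ nearestDist y i / 100 := by
    have := mul_le_mul_of_nonneg_right hη1 hnn0; linarith
  have hnn : 0 < nearestDist y i := by
    rcases hnn0.lt_or_eq with h | h
    · exact h
    · exfalso
      rw [← h] at hnn1
      have h1 : |c.nn - 0| ≤ 0 := by simpa using hnn1
      have h2 := abs_nonneg (c.nn - 0)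
      have h3 : c.nn - 0 = 0 := abs_eq_zero.mp (le_antisymm h1 h2)
      linarith
  obtain ⟨k₀, i₀, j₀, hp₀eq⟩ := id hp₀
  have ha₀_lo := core_scale_lower g hp₀eq ha₀ hlo₀ hhi₀ hη1 hnn hpt
  set nn := nearestDist y i with hnn_def
  set ε := (C * ε₁ + η) * nn with hε_def
  have hε0 : 0 ≤ ε := by rw [hε_def]; exact mul_nonneg (add_nonneg (mul_nonneg hC hε₁.le) hη) hnn0
  have hεnn : ε ≤ nn / 50 := by
    rw [hε_def]; have := mul_le_mul_of_nonneg_right (show C * ε₁ + η ≤ 1 / 50 by linarith) hnn0; linarith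
  have nc : ∀ x, ‖c.a₀ • c.B x‖ = c.a₀ * ‖c.B x‖ := fun x => by rw [norm_smul, Real.norm_eq_abs, abs_of_pos hca]
  have nb : ∀ z, ‖a₀ • B₀ z‖ = a₀ * ‖B₀ z‖ := fun z => by rw [norm_smul, Real.norm_eq_abs, abs_of_pos ha₀]
  -- bounds on `c.nn`, `c.a₀`
  obtain ⟨hnn1a, hnn1b⟩ := abs_le.mp hnn1
  have hcnn_lo : 99 / 100 * nn ≤ c.nn := by linarith
  have hcnn_hi : c.nn ≤ 101 / 100 * nn := by linarith
  have hX1 : ∀ x ∈ barlowStacking 1 (Real.sqrt (2 / 3)) c.s, x ≠ 0 → 1 ≤ ‖x‖ := fun x hx hx0 => by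
    rcases norm_eq_one_or_sqrt_two_le hcs hx hx0 with h | h
    · exact h.ge
    · linarith
  have hca_hi : c.a₀ * (22 / 25) ≤ c.nn := by
    have h1 := hlo pm
    have h2 := hX1 pm hpmX hpm0
    rw [hpmeq]; exact mul_le_mul_of_nonneg_left (by linarith) hca.le
  have hσ := cast_letter_eq hcs 0
  have hτ := neg_cast_letter_eq hcs (0 - 1)
  have he₀ : (2 : ℝ)⁻¹ • triangularVec₁ (2 : ℝ) ∈ barlowShell (c.s 0 : ℝ) (-((c.s (0 - 1) : ℤ) : ℝ)) :=
    ⟨_, hexagonSet_subset_layerShell _ _ (by simp [hexagonSet]), rfl⟩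
  have he₀1 : ‖(2 : ℝ)⁻¹ • triangularVec₁ (2 : ℝ)‖ = 1 := norm_eq_one_of_mem_barlowShell hσ hτ he₀
  have he₀0 : (2 : ℝ)⁻¹ • triangularVec₁ (2 : ℝ) ≠ 0 := fun h => by rw [h, norm_zero] at he₀1; exact zero_ne_one he₀1
  have hca_lo : c.nn ≤ c.a₀ * (28 / 25) := by
    refine (hmin _ (mem_of_mem_originShell hcs he₀) he₀0).trans ?_
    have := hhi ((2 : ℝ)⁻¹ • triangularVec₁ (2 : ℝ))
    rw [he₀1] at this
    exact mul_le_mul_of_nonneg_left (by linarith) hca.le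
  -- the based copy `Z = g(𝓛(s) − p₀)` and the two matchings
  have hVg : ∀ v, g.toLinearIsometry v = g v := fun v => rfl
  have M1 : ∀ x ∈ barlowStacking 1 (Real.sqrt (2 / 3)) c.s, ‖c.a₀ • c.B x‖ ≤ 899 / 100 * nn →
      ∃ z ∈ basedImage g.toLinearIsometry s p₀, ‖c.a₀ • c.B x - a₀ • B₀ z‖ ≤ ε := by
    intro x hx hρ
    obtain ⟨k, hk⟩ := hcl3 x hx (by rw [← nc]; linarith)
    have hki : dist (y k) (y i) ≤ 9 * nn := by
      calc dist (y k) (y i) ≤ dist (y k) (y i + c.a₀ • c.B x) + dist (y i + c.a₀ • c.B x) (y i) := dist_triangle _ _ _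
        _ ≤ C * ε₁ * nn + ‖c.a₀ • c.B x‖ := by rw [dist_eq_norm (y i + _), add_sub_cancel_left]; exact add_le_add hk le_rfl
        _ ≤ 9 * nn := by linarith
    obtain ⟨q, hq, hqk⟩ := hsite k hki
    refine ⟨g.toLinearIsometry (q - p₀), mem_basedImage_of_mem _ p₀ hq, ?_⟩
    rw [hVg]
    calc ‖c.a₀ • c.B x - a₀ • B₀ (g (q - p₀))‖ = dist (y i + c.a₀ • c.B x) (y i + a₀ • B₀ (g (q - p₀))) := by
          rw [dist_eq_norm, add_sub_add_left_eq_sub]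
      _ ≤ dist (y k) (y i + c.a₀ • c.B x) + dist (y k) (y i + a₀ • B₀ (g (q - p₀))) := dist_triangle_left _ _ _
      _ ≤ C * ε₁ * nn + η * nn := add_le_add hk hqk
      _ = ε := by rw [hε_def]; ring
  have M2 : ∀ z ∈ basedImage g.toLinearIsometry s p₀, ‖a₀ • B₀ z‖ ≤ 899 / 100 * nn →
      ∃ x ∈ barlowStacking 1 (Real.sqrt (2 / 3)) c.s, ‖c.a₀ • c.B x - a₀ • B₀ z‖ ≤ ε := by
    intro z hz hρ
    obtain ⟨q, hq, hqz⟩ := mem_basedImage_iff.1 hz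
    rw [← hqz, hVg] at hρ ⊢
    obtain ⟨k, hk⟩ := hpt q hq (by rw [← nb]; linarith)
    have hki : dist (y k) (y i) ≤ 9 * nn := by
      calc dist (y k) (y i) ≤ dist (y k) (y i + a₀ • B₀ (g (q - p₀))) + dist (y i + a₀ • B₀ (g (q - p₀))) (y i) := dist_triangle _ _ _
        _ ≤ η * nn + ‖a₀ • B₀ (g (q - p₀))‖ := by rw [dist_eq_norm (y i + _), add_sub_cancel_left]; exact add_le_add hk le_rfl
        _ ≤ 9 * nn := by linarith
    obtain ⟨x, hx, hxk⟩ := hcl2 k hki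
    refine ⟨x, hx, ?_⟩
    calc ‖c.a₀ • c.B x - a₀ • B₀ (g (q - p₀))‖ = dist (y i + c.a₀ • c.B x) (y i + a₀ • B₀ (g (q - p₀))) := by
          rw [dist_eq_norm, add_sub_add_left_eq_sub]
      _ ≤ dist (y k) (y i + c.a₀ • c.B x) + dist (y k) (y i + a₀ • B₀ (g (q - p₀))) := dist_triangle_left _ _ _
      _ ≤ C * ε₁ * nn + η * nn := add_le_add hxk hk
      _ = ε := by rw [hε_def]; ring
  -- the upper scale bound on `a₀` from the partner of the attained site
  have ha₀_hi : a₀ * (22 / 25) ≤ c.nn + ε := by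
    obtain ⟨z, hz, hm⟩ := M1 pm hpmX (by rw [nc, ← hpmeq]; linarith)
    have h1 : ‖a₀ • B₀ z‖ ≤ c.nn + ε := by
      have := norm_le_insert' (a₀ • B₀ z) (c.a₀ • c.B pm)
      rw [norm_sub_rev, nc, ← hpmeq] at this
      linarith
    have hz1 : 1 ≤ ‖z‖ := by
      by_contra hlt
      push Not at hlt
      have hz0 : z = 0 :=
        basedImage_eq_of_dist_lt_one hs hz (zero_mem_basedImage g.toLinearIsometry hp₀) (by rwa [dist_zero_right])
      rw [hz0, map_zero, smul_zero, sub_zero, nc, ← hpmeq] at hm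
      linarith
    rw [nb] at h1
    have h2 : a₀ * (22 / 25) ≤ a₀ * ‖B₀ z‖ := mul_le_mul_of_nonneg_left (by linarith [hlo₀ z]) ha₀.le
    linarith
  -- identification, window equivalence, assembly
  obtain ⟨U, IDENT, hD⟩ := core_identification hcs hs hp₀ g hca ha₀ hlo hhi hlo₀ hhi₀ hε0 hnn hεnn hcnn_hi hca_hi
    (by linarith) ha₀_hi ha₀_lo M1 M2
  have KEY := core_key g hca hlo hε0 hεnn hcnn_hi hca_lo M1 M2 U IDENT hD
  exact core_assembly hca hcnn hcB hmin hpmX hpm0 hpmeq hs hp₀eq (g.trans U.symm) fun p hp => KEY p hp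

/-! ## §4  The SHARP export consumed by the engine glue E4 (add-only appendix; `CoreRechart`/`core_assembly`/`coreRechart_holds` above are the landed decls, untouched) -/

/-- **Assembly of the rechart, sharp form**: `core_assembly` with two more conclusions — the rechart's affine map is `c.a₀ • c.B ∘ R` on the nose and the based straightening `R₀` is the identity on the window. [this file] -/
theorem core_assembly_sharp {c : Chart} (hca : 0 < c.a₀) (hcnn : 0 < c.nn)
    (hcB : ∃ Q : EuclideanSpace ℝ (Fin 3) →ₗᵢ[ℝ] EuclideanSpace ℝ (Fin 3), ∀ v : EuclideanSpace ℝ (Fin 3), ‖c.B v - Q v‖ ≤ 3 * (1 / 25) * ‖v‖)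
    (hmin : ∀ p ∈ barlowStacking 1 (Real.sqrt (2 / 3)) c.s, p ≠ 0 → c.nn ≤ c.a₀ * ‖c.B p‖) {pm : EuclideanSpace ℝ (Fin 3)}
    (hpmX : pm ∈ barlowStacking 1 (Real.sqrt (2 / 3)) c.s) (hpm0 : pm ≠ 0) (hpmeq : c.nn = c.a₀ * ‖c.B pm‖)
    {s : ℤ → ℤ} (hs : IsHaggSeq s) {k₀ i₀ j₀ : ℤ} {p₀ : EuclideanSpace ℝ (Fin 3)} (hp₀ : p₀ = barlowPos 1 (Real.sqrt (2 / 3)) s k₀ i₀ j₀)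
    (R : EuclideanSpace ℝ (Fin 3) ≃ₗᵢ[ℝ] EuclideanSpace ℝ (Fin 3))
    (KEY : ∀ p : EuclideanSpace ℝ (Fin 3), c.a₀ * ‖c.B (R p)‖ < 44 / 5 * c.nn →
      (R p ∈ barlowStacking 1 (Real.sqrt (2 / 3)) c.s ↔ p + p₀ ∈ barlowStacking 1 (Real.sqrt (2 / 3)) s)) :
    ∃ (c' : Chart) (R₀ : EuclideanSpace ℝ (Fin 3) ≃ₗᵢ[ℝ] EuclideanSpace ℝ (Fin 3)), Recharts (1 / 25) c c' ∧
      (∀ p : EuclideanSpace ℝ (Fin 3), p ∈ barlowStacking 1 (Real.sqrt (2 / 3)) c'.s ↔ R₀ p + p₀ ∈ barlowStacking 1 (Real.sqrt (2 / 3)) s) ∧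
      (∀ v : EuclideanSpace ℝ (Fin 3), c'.a₀ • c'.B v = c.a₀ • c.B (R v)) ∧ ∀ v : EuclideanSpace ℝ (Fin 3), R₀ v = v := by
  have KEY' : ∀ p : EuclideanSpace ℝ (Fin 3), c.a₀ * ‖c.B (R p)‖ < 44 / 5 * c.nn →
      (R p ∈ barlowStacking 1 (Real.sqrt (2 / 3)) c.s ↔ p ∈ barlowStacking 1 (Real.sqrt (2 / 3)) (fun n => s (n + k₀))) :=
    fun p hp => (KEY p hp).trans (mem_shift_iff hp₀ p).symm
  have hs' : IsHaggSeq (fun n => s (n + k₀)) := fun n => hs (n + k₀)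
  obtain ⟨Q, hQ⟩ := hcB
  have hQ' : ∃ Q' : EuclideanSpace ℝ (Fin 3) →ₗᵢ[ℝ] EuclideanSpace ℝ (Fin 3), ∀ v, ‖(c.B ∘ₗ (R.toLinearEquiv : EuclideanSpace ℝ (Fin 3) →ₗ[ℝ] EuclideanSpace ℝ (Fin 3))) v - Q' v‖ ≤ 3 * (1 / 25) * ‖v‖ :=
    ⟨Q.comp R.toLinearIsometry, fun v => by rw [← R.norm_map v]; exact hQ (R v)⟩
  have hB' : ∀ p, (c.B ∘ₗ (R.toLinearEquiv : EuclideanSpace ℝ (Fin 3) →ₗ[ℝ] EuclideanSpace ℝ (Fin 3))) p = c.B (R p) := fun p => rfl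
  refine ⟨⟨fun n => s (n + k₀), c.B ∘ₗ (R.toLinearEquiv : EuclideanSpace ℝ (Fin 3) →ₗ[ℝ] EuclideanSpace ℝ (Fin 3)), c.a₀, c.nn⟩, LinearIsometryEquiv.refl ℝ (EuclideanSpace ℝ (Fin 3)),
    ⟨⟨hs', hca, hcnn, hQ', ?_, ?_, ?_⟩, rfl, rfl, R, hB', KEY'⟩, fun p => mem_shift_iff hp₀ p, fun v => rfl, fun v => rfl⟩
  · -- `c.nn` is a lower bound of the new reference distances
    intro p hp hp0
    show c.nn ≤ c.a₀ * ‖(c.B ∘ₗ (R.toLinearEquiv : EuclideanSpace ℝ (Fin 3) →ₗ[ℝ] EuclideanSpace ℝ (Fin 3))) p‖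
    rw [hB']
    by_cases h8 : c.a₀ * ‖c.B (R p)‖ < 44 / 5 * c.nn
    · refine hmin (R p) ((KEY' p h8).2 hp) fun h0 => hp0 ?_
      exact R.injective (h0.trans (map_zero R).symm)
    · push Not at h8; linarith
  · -- and it is attained, at `R⁻¹` of the attained site of `c`
    refine ⟨R.symm pm, (KEY' (R.symm pm) ?_).1 (by rw [R.apply_symm_apply]; exact hpmX), fun h => hpm0 ?_, ?_⟩
    · rw [R.apply_symm_apply, ← hpmeq]; linarith
    · rw [← R.apply_symm_apply pm, h, map_zero]
    · show c.nn = c.a₀ * ‖(c.B ∘ₗ (R.toLinearEquiv : EuclideanSpace ℝ (Fin 3) →ₗ[ℝ] EuclideanSpace ℝ (Fin 3))) (R.symm pm)‖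
      rw [hB', R.apply_symm_apply]; exact hpmeq
  · -- summability of the new site-energy series (`…AffineBarlowSum`)
    exact summable_lennardJones_chart hs' (m := 3 * (1 / 25)) (by norm_num) hQ' hca

/-- **CORE♯ · `CoreRechartSharp θ`**: `CoreRechart θ` VERBATIM with one more conclusion — the rechart's affine map `c'.a₀ • c'.B` is `(4/17)(Cε₁ + η) nn`-close PER UNIT LENGTH to the based chart's `a₀ • B₀ ∘ g ∘ R₀` (the net bound of C4, which the plain `CoreRechart` hides). [this file] -/
def CoreRechartSharp (θ : ℝ) : Prop :=
  ∀ (C η ε₁ : ℝ), 0 ≤ C → 0 ≤ η → 0 < ε₁ → C * ε₁ ≤ 1 / 100 → η ≤ 1 / 100 →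
    ∀ (N : ℕ) (y : Fin N → EuclideanSpace ℝ (Fin 3)) (i : Fin N) (c : Chart), IsChart C ε₁ y i c → ChartAdmissible θ c →
      ∀ (a₀ : ℝ) (B₀ : EuclideanSpace ℝ (Fin 3) →ₗ[ℝ] EuclideanSpace ℝ (Fin 3)) (s : ℤ → ℤ)
        (g : EuclideanSpace ℝ (Fin 3) ≃ₗᵢ[ℝ] EuclideanSpace ℝ (Fin 3)) (p₀ : EuclideanSpace ℝ (Fin 3)),
        0 < a₀ → (∃ Q₀ : EuclideanSpace ℝ (Fin 3) →ₗᵢ[ℝ] EuclideanSpace ℝ (Fin 3), ∀ v, ‖B₀ v - Q₀ v‖ ≤ 3 * θ * ‖v‖) →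
        IsHaggSeq s → p₀ ∈ barlowStacking 1 (Real.sqrt (2 / 3)) s →
        (∀ k : Fin N, dist (y k) (y i) ≤ 9 * nearestDist y i →
          ∃ q ∈ barlowStacking 1 (Real.sqrt (2 / 3)) s, dist (y k) (y i + a₀ • B₀ (g (q - p₀))) ≤ η * nearestDist y i) →
        (∀ q ∈ barlowStacking 1 (Real.sqrt (2 / 3)) s, a₀ * ‖B₀ (g (q - p₀))‖ ≤ 9 * nearestDist y i →
          ∃ k : Fin N, dist (y k) (y i + a₀ • B₀ (g (q - p₀))) ≤ η * nearestDist y i) →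
        ∃ (c' : Chart) (R₀ : EuclideanSpace ℝ (Fin 3) ≃ₗᵢ[ℝ] EuclideanSpace ℝ (Fin 3)), Recharts θ c c' ∧
          (∀ p : EuclideanSpace ℝ (Fin 3),
            p ∈ barlowStacking 1 (Real.sqrt (2 / 3)) c'.s ↔ R₀ p + p₀ ∈ barlowStacking 1 (Real.sqrt (2 / 3)) s) ∧
          ∀ v : EuclideanSpace ℝ (Fin 3),
            ‖c'.a₀ • c'.B v - a₀ • B₀ (g (R₀ v))‖ ≤ 4 / 17 * ((C * ε₁ + η) * nearestDist y i) * ‖v‖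

/-- `CoreRechartSharp θ → CoreRechart θ` (drop the last conclusion). [this file] -/
theorem coreRechart_of_sharp {θ : ℝ} (h : CoreRechartSharp θ) : CoreRechart θ := by
  intro C η ε₁ hC hη hε₁ hCε hη1 N y i c hchart hadm a₀ B₀ s g p₀ ha₀ hB₀ hs hp₀ hsite hpt
  obtain ⟨c', R₀, hrc, hiff, -⟩ := h C η ε₁ hC hη hε₁ hCε hη1 N y i c hchart hadm a₀ B₀ s g p₀ ha₀ hB₀ hs hp₀ hsite hpt
  exact ⟨c', R₀, hrc, hiff⟩


/-- **★ CORE♯ (PROVED): `CoreRechartSharp (1/25)`** — the proof of `coreRechart_holds` above, run through `core_assembly_sharp` and keeping the net bound of `core_key`. [this file] -/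
theorem coreRechartSharp_holds : CoreRechartSharp (1 / 25) := by
  intro C η ε₁ hC hη hε₁ hCε hη1 N y i c hchart hadm a₀ B₀ s g p₀ ha₀ hB₀ hs hp₀ hsite hpt
  obtain ⟨hnn1, hcl2, hcl3⟩ := hchart
  obtain ⟨hcs, hca, hcnn, hcB, hmin, ⟨pm, hpmX, hpm0, hpmeq⟩, -⟩ := hadm
  obtain ⟨hlo, hhi⟩ := near_iso_bounds hcB
  obtain ⟨hlo₀, hhi₀⟩ := near_iso_bounds hB₀
  have h72 : (7 / 5 : ℝ) < Real.sqrt 2 := by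
    rw [show (7 / 5 : ℝ) = Real.sqrt ((7 / 5) ^ 2) by rw [Real.sqrt_sq (by norm_num)]]
    exact Real.sqrt_lt_sqrt (by norm_num) (by norm_num)
  -- the length unit `nn > 0` and the accuracy `ε`
  have hnn0 : 0 ≤ nearestDist y i := nearestDist_nonneg y i
  have hb : C * ε₁ * nearestDist y i ≤ nearestDist y i / 100 := by
    have := mul_le_mul_of_nonneg_right hCε hnn0; linarith
  have hηnn : η * nearestDist y i ≤ nearestDist y i / 100 := by
    have := mul_le_mul_of_nonneg_right hη1 hnn0; linarith
  have hnn : 0 < nearestDist y i := by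
    rcases hnn0.lt_or_eq with h | h
    · exact h
    · exfalso
      rw [← h] at hnn1
      have h1 : |c.nn - 0| ≤ 0 := by simpa using hnn1
      have h2 := abs_nonneg (c.nn - 0)
      have h3 : c.nn - 0 = 0 := abs_eq_zero.mp (le_antisymm h1 h2)
      linarith
  obtain ⟨k₀, i₀, j₀, hp₀eq⟩ := id hp₀
  have ha₀_lo := core_scale_lower g hp₀eq ha₀ hlo₀ hhi₀ hη1 hnn hpt
  set nn := nearestDist y i with hnn_def
  set ε := (C * ε₁ + η) * nn with hε_def
  have hε0 : 0 ≤ ε := by rw [hε_def]; exact mul_nonneg (add_nonneg (mul_nonneg hC hε₁.le) hη) hnn0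
  have hεnn : ε ≤ nn / 50 := by
    rw [hε_def]; have := mul_le_mul_of_nonneg_right (show C * ε₁ + η ≤ 1 / 50 by linarith) hnn0; linarith
  have nc : ∀ x, ‖c.a₀ • c.B x‖ = c.a₀ * ‖c.B x‖ := fun x => by rw [norm_smul, Real.norm_eq_abs, abs_of_pos hca]
  have nb : ∀ z, ‖a₀ • B₀ z‖ = a₀ * ‖B₀ z‖ := fun z => by rw [norm_smul, Real.norm_eq_abs, abs_of_pos ha₀]
  -- bounds on `c.nn`, `c.a₀`
  obtain ⟨hnn1a, hnn1b⟩ := abs_le.mp hnn1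
  have hcnn_lo : 99 / 100 * nn ≤ c.nn := by linarith
  have hcnn_hi : c.nn ≤ 101 / 100 * nn := by linarith
  have hX1 : ∀ x ∈ barlowStacking 1 (Real.sqrt (2 / 3)) c.s, x ≠ 0 → 1 ≤ ‖x‖ := fun x hx hx0 => by
    rcases norm_eq_one_or_sqrt_two_le hcs hx hx0 with h | h
    · exact h.ge
    · linarith
  have hca_hi : c.a₀ * (22 / 25) ≤ c.nn := by
    have h1 := hlo pm
    have h2 := hX1 pm hpmX hpm0
    rw [hpmeq]; exact mul_le_mul_of_nonneg_left (by linarith) hca.le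
  have hσ := cast_letter_eq hcs 0
  have hτ := neg_cast_letter_eq hcs (0 - 1)
  have he₀ : (2 : ℝ)⁻¹ • triangularVec₁ (2 : ℝ) ∈ barlowShell (c.s 0 : ℝ) (-((c.s (0 - 1) : ℤ) : ℝ)) :=
    ⟨_, hexagonSet_subset_layerShell _ _ (by simp [hexagonSet]), rfl⟩
  have he₀1 : ‖(2 : ℝ)⁻¹ • triangularVec₁ (2 : ℝ)‖ = 1 := norm_eq_one_of_mem_barlowShell hσ hτ he₀
  have he₀0 : (2 : ℝ)⁻¹ • triangularVec₁ (2 : ℝ) ≠ 0 := fun h => by rw [h, norm_zero] at he₀1; exact zero_ne_one he₀1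
  have hca_lo : c.nn ≤ c.a₀ * (28 / 25) := by
    refine (hmin _ (mem_of_mem_originShell hcs he₀) he₀0).trans ?_
    have := hhi ((2 : ℝ)⁻¹ • triangularVec₁ (2 : ℝ))
    rw [he₀1] at this
    exact mul_le_mul_of_nonneg_left (by linarith) hca.le
  -- the based copy `Z = g(𝓛(s) − p₀)` and the two matchings
  have hVg : ∀ v, g.toLinearIsometry v = g v := fun v => rfl
  have M1 : ∀ x ∈ barlowStacking 1 (Real.sqrt (2 / 3)) c.s, ‖c.a₀ • c.B x‖ ≤ 899 / 100 * nn →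
      ∃ z ∈ basedImage g.toLinearIsometry s p₀, ‖c.a₀ • c.B x - a₀ • B₀ z‖ ≤ ε := by
    intro x hx hρ
    obtain ⟨k, hk⟩ := hcl3 x hx (by rw [← nc]; linarith)
    have hki : dist (y k) (y i) ≤ 9 * nn := by
      calc dist (y k) (y i) ≤ dist (y k) (y i + c.a₀ • c.B x) + dist (y i + c.a₀ • c.B x) (y i) := dist_triangle _ _ _
        _ ≤ C * ε₁ * nn + ‖c.a₀ • c.B x‖ := by rw [dist_eq_norm (y i + _), add_sub_cancel_left]; exact add_le_add hk le_rfl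
        _ ≤ 9 * nn := by linarith
    obtain ⟨q, hq, hqk⟩ := hsite k hki
    refine ⟨g.toLinearIsometry (q - p₀), mem_basedImage_of_mem _ p₀ hq, ?_⟩
    rw [hVg]
    calc ‖c.a₀ • c.B x - a₀ • B₀ (g (q - p₀))‖ = dist (y i + c.a₀ • c.B x) (y i + a₀ • B₀ (g (q - p₀))) := by
          rw [dist_eq_norm, add_sub_add_left_eq_sub]
      _ ≤ dist (y k) (y i + c.a₀ • c.B x) + dist (y k) (y i + a₀ • B₀ (g (q - p₀))) := dist_triangle_left _ _ _
      _ ≤ C * ε₁ * nn + η * nn := add_le_add hk hqk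
      _ = ε := by rw [hε_def]; ring
  have M2 : ∀ z ∈ basedImage g.toLinearIsometry s p₀, ‖a₀ • B₀ z‖ ≤ 899 / 100 * nn →
      ∃ x ∈ barlowStacking 1 (Real.sqrt (2 / 3)) c.s, ‖c.a₀ • c.B x - a₀ • B₀ z‖ ≤ ε := by
    intro z hz hρ
    obtain ⟨q, hq, hqz⟩ := mem_basedImage_iff.1 hz
    rw [← hqz, hVg] at hρ ⊢
    obtain ⟨k, hk⟩ := hpt q hq (by rw [← nb]; linarith)
    have hki : dist (y k) (y i) ≤ 9 * nn := by
      calc dist (y k) (y i) ≤ dist (y k) (y i + a₀ • B₀ (g (q - p₀))) + dist (y i + a₀ • B₀ (g (q - p₀))) (y i) := dist_triangle _ _ _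
        _ ≤ η * nn + ‖a₀ • B₀ (g (q - p₀))‖ := by rw [dist_eq_norm (y i + _), add_sub_cancel_left]; exact add_le_add hk le_rfl
        _ ≤ 9 * nn := by linarith
    obtain ⟨x, hx, hxk⟩ := hcl2 k hki
    refine ⟨x, hx, ?_⟩
    calc ‖c.a₀ • c.B x - a₀ • B₀ (g (q - p₀))‖ = dist (y i + c.a₀ • c.B x) (y i + a₀ • B₀ (g (q - p₀))) := by
          rw [dist_eq_norm, add_sub_add_left_eq_sub]
      _ ≤ dist (y k) (y i + c.a₀ • c.B x) + dist (y k) (y i + a₀ • B₀ (g (q - p₀))) := dist_triangle_left _ _ _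
      _ ≤ C * ε₁ * nn + η * nn := add_le_add hxk hk
      _ = ε := by rw [hε_def]; ring
  -- the upper scale bound on `a₀` from the partner of the attained site
  have ha₀_hi : a₀ * (22 / 25) ≤ c.nn + ε := by
    obtain ⟨z, hz, hm⟩ := M1 pm hpmX (by rw [nc, ← hpmeq]; linarith)
    have h1 : ‖a₀ • B₀ z‖ ≤ c.nn + ε := by
      have := norm_le_insert' (a₀ • B₀ z) (c.a₀ • c.B pm)
      rw [norm_sub_rev, nc, ← hpmeq] at this
      linarith
    have hz1 : 1 ≤ ‖z‖ := by
      by_contra hlt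
      push Not at hlt
      have hz0 : z = 0 :=
        basedImage_eq_of_dist_lt_one hs hz (zero_mem_basedImage g.toLinearIsometry hp₀) (by rwa [dist_zero_right])
      rw [hz0, map_zero, smul_zero, sub_zero, nc, ← hpmeq] at hm
      linarith
    rw [nb] at h1
    have h2 : a₀ * (22 / 25) ≤ a₀ * ‖B₀ z‖ := mul_le_mul_of_nonneg_left (by linarith [hlo₀ z]) ha₀.le
    linarith
  -- identification, window equivalence, assembly
  obtain ⟨U, IDENT, hD⟩ := core_identification hcs hs hp₀ g hca ha₀ hlo hhi hlo₀ hhi₀ hε0 hnn hεnn hcnn_hi hca_hi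
    (by linarith) ha₀_hi ha₀_lo M1 M2
  have KEY := core_key g hca hlo hε0 hεnn hcnn_hi hca_lo M1 M2 U IDENT hD
  obtain ⟨c', R₀, hrc, hiff, hB', hR₀⟩ := core_assembly_sharp hca hcnn hcB hmin hpmX hpm0 hpmeq hs hp₀eq (g.trans U.symm) fun p hp => KEY p hp
  refine ⟨c', R₀, hrc, hiff, fun v => ?_⟩
  have h1 := hD (U.symm (g v))
  rw [U.apply_symm_apply, LinearIsometryEquiv.norm_map, LinearIsometryEquiv.norm_map] at h1
  rw [hB', hR₀ v]
  show ‖c.a₀ • c.B (U.symm (g v)) - a₀ • B₀ (g v)‖ ≤ 4 / 17 * ((C * ε₁ + η) * nn) * ‖v‖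
  have h2 : ε / (5 - 3 / 4) * ‖v‖ = 4 / 17 * ((C * ε₁ + η) * nn) * ‖v‖ := by rw [hε_def]; ring
  linarith

end Summit.AtomisticToContinuum.Crystallization.Theorems.OverbindingBudgetAffineFarSmoothSplit
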